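import Summits.QuantumFields.YangMills.Theorems.BalabanUVNodesN15KingModelTorusPeriodisation
import HarnessLib

/-!
# BalabanUVNodes ∕ N15 — THE KING-MODEL RUNG (PART Ε-e): KING's TORUS COVARIANCE IN KING's OWN PLANE WAVES —
# `(lapF K c m²)⁻¹(x, y) = |Ω|⁻¹ Σ_{q ∈ Ω̂} e^{iq·(x−y)} ∕ (m² + cΣ_μ(2 − 2cos p′_μ(q)))` (every torus `Ω = Π_μℤ∕K_μ`, `c ≥ 0`, `m² > 0`), the DIAGONAL DOMINATES, `1∕(m²+4c(d+1)) ≤ (lapF)⁻¹(x,x) ≤ 1∕m²`,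
# and the DICTIONARY with the B5 (1.29) dual-grid form of part Ε-b
# (Track A, DAG node N15 = NE2; FAN-OUT v1.1 §N15 s3 «KING-MODEL RUNG»; the fine-covariance companion of part Ϡ-d's `blockCov_eq_fourier`; count-neutral)

HONEST FRAMING.  Count-neutral (cell `pub-ymgap`, seat `pub-ymgap-dag-n15-e` g40; `--supports stmt-QuantumFields-27366 --as helper` = K3⁸).
TEMPLATE LITERATURE: C. King, Commun. Math. Phys. **102** (1986) 649–677 [King1986], (4.4) p.670 (the symbol `Δ^η(p) + m²` of `c(−Δ) + m²`; tree `King1986.Torus.lapSym`),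
(4.35) p.674 (plane-wave sums over the dual torus `Ω̂` with the characters `e^{iq·x}`; tree `B5Prop11Plancherel.chi`, reduced momenta `sOf`); T. Bałaban, Commun. Math. Phys. **95**
(1984) 17–40 [Balaban1984PropagatorsI], (1.29) p.23 (the dual torus and the finite Fourier inversion).  (King's (4.1) p.670 is the Fourier transform on the INFINITE lattice
`ηZ^d`; the finite-torus form used here is B5's (1.29) — referee ref-K READ-666.)  Part Ϡ-d (g32) gave the plane-wave formula for NE2's UNIT-LAYER kernel `(Δ^{(K)})⁻¹`
(`blockCov_eq_fourier`: `a_K⁻¹[b=b′] + |Ω|⁻¹Σ_q S_K(q)Re e^{iq·(b′−b)}`); part Ε-b gave the torus covariance in B5's dual-grid variables (`lapF_inv_eq_torusFreeKerC`, via the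
`ℤ^{d+1}` engine).  THIS FILE is the same object in KING's OWN vocabulary (`chi`, `sOf`, `lapSym` of `King1986.EffectiveLaplacianSymbol` ∕ `TorusBlockForm`), by a direct
finite computation on the torus — no infinite lattice, no Poisson summation:
§1 `kingPlaneWave c m² K x y := |Ω|⁻¹ Σ_q (lapSym K c m² q)⁻¹·e^{iq·(x−y)}`; ★ `sum_lapF_mul_chi` (plane waves are eigenvectors: `Σ_z lapF(x,z)e^{iq·(z−y)} = lapSym(q)·e^{iq·(x−y)}`,
from the tree's `kernel_sum_lapF` + translation invariance); ★★ `sum_lapF_mul_kingPlaneWave` (`lapF · P = δ`: character orthogonality `sum_chi_left`); §2 by invertibility of `lapF`: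
★★★ **`lapF_inv_eq_kingPlaneWave`** (complex form) and ★★★ **`lapF_inv_apply_eq_fourier`** (`(lapF K c m²)⁻¹(x,y) = |Ω|⁻¹ Σ_q (lapSym K c m² q)⁻¹·Re e^{iq·(x−y)}` — the companion
of `blockCov_eq_fourier` for the FINE covariance); §3 consequences read off the formula: ★★ `lapF_inv_diag_eq` (`(lapF)⁻¹(x,x) = |Ω|⁻¹Σ_q (lapSym q)⁻¹`, the same for all `x`),
★★ `abs_lapF_inv_le_diag` (THE DIAGONAL DOMINATES: `|(lapF)⁻¹(x,y)| ≤ (lapF)⁻¹(x,x)`, `|e^{iq·w}| ≤ 1`), ★★ `lapF_inv_diag_le_inv_mass` (`≤ 1∕m²`, `lapSym ≥ m²`),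
★★ `inv_le_lapF_inv_diag` (`≥ 1∕(m² + 4c(d+1))`, `lapSym ≤ m² + 4c(d+1)`); §4 ★★ **`torusFreeKerC_eq_kingPlaneWave`** — THE DICTIONARY: part Ε-b's B5 dual-grid kernel
`torusFreeKerC c m² K (torRepZ x − torRepZ y)` EQUALS King's plane-wave sum (both are `(lapF)⁻¹(x,y)`); hence ★★ `tsum_freeKer_translate_eq_kingPlaneWave` (the periodised free
kernel in King's plane waves).

PRIOR TREE ART (used, not restated): `King1986.EffectiveLaplacianSymbol` (`lapF`, `lapSym`, `kernel_sum_lapF`, `lapF_transl`, `lapF_comm`, `lapSym_ge`), `King1986.TorusBlockForm`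
(`chi_comm`, `sum_chi_left`), `B5Prop11Plancherel` (`chi`, `chi_add_right`, `sOf`), part Ϻ's `isUnit_lapF` ∕ `lapF_mulVec_injective`, part Ε-b.  NOT Bałaban's covariant objects
(no plane waves at `U ≠ 1`); NOT a node discharge (N15 is booked through n15-a's knit, untouched); nothing continuum-YM ∕ `ℝ⁴` ∕ OS ∕ Clay.  0 `sorry`; 1 `def` (`kingPlaneWave`).

HONEST SCOPE.  Exact identities + the two elementary bounds `m² ≤ lapSym ≤ m² + 4c(d+1)`; every period vector `K` (all `K_μ ≥ 1`), `c ≥ 0`, `m² > 0`, any `d`.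
Locators: [King1986] (4.4) p.670, (4.35) p.674, (2.13) p.653; [Balaban1984PropagatorsI] (1.29) p.23.
-/

noncomputable section

open scoped BigOperators ComplexConjugate
open Finset Complex Matrix

namespace Summit.QuantumFields.YangMills.BalabanUVNodes.N15KingModelRung.TorusSpectral

open Literature.MathematicalPhysics.QuantumFieldTheory.Balaban1983to89.B5Prop11Plancherel (Tor unitVec chi chi_add_right)
open Literature.MathematicalPhysics.QuantumFieldTheory.Balaban1983to89.B4TorusKernel.MultiPeriod (translate)
open Literature.MathematicalPhysics.QuantumFieldTheory.King1986.Torus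
open Summit.QuantumFields.YangMills.BalabanUVNodes.N15KingModelRung.ProperTime (isUnit_lapF lapF_mulVec_injective)

variable {d : ℕ}

/-! ## §1 King's plane-wave sum and the column equation -/

section PlaneWave

variable (c m2 : ℝ) (K : Fin (d + 1) → ℕ) [hK : ∀ μ, NeZero (K μ)]

/-- KING's PLANE-WAVE SUM for the torus covariance: `P(x,y) = |Ω|⁻¹ Σ_{q ∈ Ω̂} e^{iq·(x−y)} ∕ (m² + cΣ_μ(2 − 2cos p′_μ(q)))`. [cite: King1986, (4.4) p.670, (4.35) p.674;
Balaban1984PropagatorsI, (1.29) p.23] -/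
def kingPlaneWave (x y : Tor K) : ℂ := (Fintype.card (Tor K) : ℂ)⁻¹ * ∑ q : Tor K, ((lapSym K c m2 q)⁻¹ : ℝ) * chi K q (x - y)

variable {c m2}

/-- ★ PLANE WAVES ARE EIGENVECTORS OF `c(−Δ) + m²`: `Σ_z lapF(x,z)·e^{iq·(z−y)} = lapSym(q)·e^{iq·(x−y)}` (the tree's kernel-row identity `kernel_sum_lapF` moved to the row of
`x` by translation invariance). [cite: King1986, (4.4) p.670] -/
theorem sum_lapF_mul_chi (c m2 : ℝ) (q x y : Tor K) :
    ∑ z : Tor K, (lapF K c m2 x z : ℂ) * chi K q (z - y) = (lapSym K c m2 q : ℂ) * chi K q (x - y) := by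
  have h := kernel_sum_lapF K c m2 q
  rw [← Fintype.sum_equiv (Equiv.addRight x) (fun w => (lapF K c m2 x (w + x) : ℂ) * chi K q (w + x - y)) _ (fun w => rfl)]
  have e : ∀ w : Tor K, (lapF K c m2 x (w + x) : ℂ) * chi K q (w + x - y) = ((lapF K c m2 w 0 : ℂ) * chi K q w) * chi K q (x - y) := by
    intro w
    rw [show lapF K c m2 x (w + x) = lapF K c m2 w 0 by rw [← lapF_transl K c m2 w 0 x, zero_add]; exact lapF_comm K c m2 (w + x) x,
      show w + x - y = w + (x - y) by abel, chi_add_right]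
    ring
  simp_rw [e]
  rw [← Finset.sum_mul, h]

/-- ★★ THE COLUMN EQUATION `(c(−Δ)+m²)·P(·,y) = δ_y`: eigenvalue × inverse symbol = 1, then character orthogonality `Σ_q e^{iq·w} = |Ω|δ_{w,0}`. [cite: King1986, (4.4) p.670, (4.35) p.674] -/
theorem sum_lapF_mul_kingPlaneWave (hc : 0 ≤ c) (hm : 0 < m2) (x y : Tor K) :
    ∑ z : Tor K, (lapF K c m2 x z : ℂ) * kingPlaneWave c m2 K z y = if x = y then 1 else 0 := by
  have hcard : (Fintype.card (Tor K) : ℂ) ≠ 0 := by exact_mod_cast Fintype.card_ne_zero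
  have hsym : ∀ q : Tor K, (lapSym K c m2 q : ℂ) ≠ 0 := fun q => by exact_mod_cast (lt_of_lt_of_le hm (lapSym_ge K c m2 hc q)).ne'
  unfold kingPlaneWave
  simp_rw [Finset.mul_sum]
  rw [Finset.sum_comm]
  have hq : ∀ q : Tor K, ∑ z : Tor K, (lapF K c m2 x z : ℂ) * ((Fintype.card (Tor K) : ℂ)⁻¹ * ((((lapSym K c m2 q)⁻¹ : ℝ) : ℂ) * chi K q (z - y)))
      = (Fintype.card (Tor K) : ℂ)⁻¹ * chi K q (x - y) := by
    intro q
    have e : ∀ z : Tor K, (lapF K c m2 x z : ℂ) * ((Fintype.card (Tor K) : ℂ)⁻¹ * ((((lapSym K c m2 q)⁻¹ : ℝ) : ℂ) * chi K q (z - y)))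
        = (Fintype.card (Tor K) : ℂ)⁻¹ * (((lapSym K c m2 q)⁻¹ : ℝ) : ℂ) * ((lapF K c m2 x z : ℂ) * chi K q (z - y)) := fun z => by ring
    simp_rw [e]
    rw [← Finset.mul_sum, sum_lapF_mul_chi K c m2 q x y, Complex.ofReal_inv, mul_assoc, ← mul_assoc ((lapSym K c m2 q : ℂ))⁻¹,
      inv_mul_cancel₀ (hsym q), one_mul]
  simp_rw [hq]
  rw [← Finset.mul_sum, sum_chi_left K (x - y)]
  split_ifs with h1 h2 h2
  · exact inv_mul_cancel₀ hcard
  · exact absurd (sub_eq_zero.mp h1) h2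
  · exact absurd (sub_eq_zero.mpr h2) h1
  · rw [mul_zero]

end PlaneWave

/-! ## §2 The torus covariance in King's plane waves -/

section Inverse

variable (K : Fin (d + 1) → ℕ) [hK : ∀ μ, NeZero (K μ)] {c m2 : ℝ}

/-- the real part of the plane-wave sum is a right inverse of `lapF`. [folklore] -/
theorem lapF_mul_re_kingPlaneWave (hc : 0 ≤ c) (hm : 0 < m2) :
    lapF K c m2 * (Matrix.of fun x y : Tor K => (kingPlaneWave c m2 K x y).re) = 1 := by
  ext x y
  have h := congrArg Complex.re (sum_lapF_mul_kingPlaneWave K hc hm x y)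
  rw [Complex.re_sum] at h
  simp only [Complex.re_ofReal_mul] at h
  have hre : (if x = y then (1 : ℂ) else 0).re = if x = y then 1 else 0 := by split_ifs <;> simp
  rw [hre] at h
  rw [Matrix.mul_apply, Matrix.one_apply, ← h]
  rfl

/-- the imaginary part of the plane-wave sum vanishes. [folklore] -/
theorem im_kingPlaneWave (hc : 0 ≤ c) (hm : 0 < m2) (x y : Tor K) : (kingPlaneWave c m2 K x y).im = 0 := by
  have hcol : (lapF K c m2 *ᵥ fun z => (kingPlaneWave c m2 K z y).im) = lapF K c m2 *ᵥ 0 := by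
    funext x'
    have h := congrArg Complex.im (sum_lapF_mul_kingPlaneWave K hc hm x' y)
    rw [Complex.im_sum] at h
    simp only [Complex.im_ofReal_mul] at h
    have him : (if x' = y then (1 : ℂ) else 0).im = 0 := by split_ifs <;> simp
    rw [him] at h
    rw [Matrix.mulVec_zero, Pi.zero_apply, ← h]
    rfl
  exact congrFun (lapF_mulVec_injective K hc hm hcol) x

/-- ★★★ **KING's TORUS COVARIANCE IN KING's PLANE WAVES** (complex form): `(lapF K c m²)⁻¹(x,y) = |Ω|⁻¹ Σ_q e^{iq·(x−y)}∕lapSym(q)` on every torus, `c ≥ 0`, `m² > 0`.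
[cite: King1986, (4.4) p.670, (4.35) p.674; Balaban1984PropagatorsI, (1.29) p.23] -/
theorem lapF_inv_eq_kingPlaneWave (hc : 0 ≤ c) (hm : 0 < m2) (x y : Tor K) :
    (((lapF K c m2)⁻¹ x y : ℝ) : ℂ) = kingPlaneWave c m2 K x y := by
  rw [Matrix.inv_eq_right_inv (lapF_mul_re_kingPlaneWave K hc hm), Matrix.of_apply]
  exact Complex.ext (by simp) (by simp [im_kingPlaneWave K hc hm x y])

/-- ★★★ **THE PLANE-WAVE FORMULA FOR THE FINE COVARIANCE** (real form, the companion of part Ϡ-d's `blockCov_eq_fourier`):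
`(lapF K c m²)⁻¹(x,y) = |Ω|⁻¹ Σ_{q ∈ Ω̂} (m² + cΣ_μ(2 − 2cos p′_μ(q)))⁻¹·Re e^{iq·(x−y)}`. [cite: King1986, (4.4) p.670, (4.35) p.674; Balaban1984PropagatorsI, (1.29) p.23] -/
theorem lapF_inv_apply_eq_fourier (hc : 0 ≤ c) (hm : 0 < m2) (x y : Tor K) :
    (lapF K c m2)⁻¹ x y = (Fintype.card (Tor K) : ℝ)⁻¹ * ∑ q : Tor K, (lapSym K c m2 q)⁻¹ * (chi K q (x - y)).re := by
  have h := congrArg Complex.re (lapF_inv_eq_kingPlaneWave K hc hm x y)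
  rw [Complex.ofReal_re] at h
  rw [h, kingPlaneWave, ← Complex.ofReal_natCast, ← Complex.ofReal_inv, Complex.re_ofReal_mul, Complex.re_sum]
  simp only [Complex.re_ofReal_mul]

end Inverse

/-! ## §3 Read off the formula: the diagonal, diagonal dominance, and the two mass bounds -/

section Consequences

variable (K : Fin (d + 1) → ℕ) [hK : ∀ μ, NeZero (K μ)] {c m2 : ℝ}

/-- ★★ **THE DIAGONAL**: `(lapF K c m²)⁻¹(x,x) = |Ω|⁻¹ Σ_q (lapSym K c m² q)⁻¹` — the mean of the inverse symbol, the same at every site. [cite: King1986, (4.4) p.670, (4.35) p.674] -/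
theorem lapF_inv_diag_eq (hc : 0 ≤ c) (hm : 0 < m2) (x : Tor K) :
    (lapF K c m2)⁻¹ x x = (Fintype.card (Tor K) : ℝ)⁻¹ * ∑ q : Tor K, (lapSym K c m2 q)⁻¹ := by
  rw [lapF_inv_apply_eq_fourier K hc hm]
  simp [sub_self, Literature.MathematicalPhysics.QuantumFieldTheory.Balaban1983to89.B5Block118.chi_zero_right]

/-- `|e^{iq·w}| = 1`. [folklore] -/
theorem norm_chi_eq_one (q w : Tor K) : ‖chi K q w‖ = 1 := by
  unfold chi
  rw [norm_prod]
  exact Finset.prod_eq_one fun μ _ => by rw [ZMod.stdAddChar_apply, Circle.norm_coe]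

/-- ★★ **THE DIAGONAL DOMINATES**: `|(lapF K c m²)⁻¹(x,y)| ≤ (lapF K c m²)⁻¹(x,x)` (`|Re e^{iq·w}| ≤ 1` termwise, all weights `(lapSym q)⁻¹ > 0`). [cite: King1986, (4.4) p.670] -/
theorem abs_lapF_inv_le_diag (hc : 0 ≤ c) (hm : 0 < m2) (x y : Tor K) : |(lapF K c m2)⁻¹ x y| ≤ (lapF K c m2)⁻¹ x x := by
  rw [lapF_inv_apply_eq_fourier K hc hm x y, lapF_inv_diag_eq K hc hm x, abs_mul, abs_of_nonneg (by positivity : (0 : ℝ) ≤ (Fintype.card (Tor K) : ℝ)⁻¹)]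
  refine mul_le_mul_of_nonneg_left (le_trans (Finset.abs_sum_le_sum_abs _ _) (Finset.sum_le_sum fun q _ => ?_)) (by positivity)
  have hq : 0 ≤ (lapSym K c m2 q)⁻¹ := inv_nonneg.mpr (le_trans hm.le (lapSym_ge K c m2 hc q))
  rw [abs_mul, abs_of_nonneg hq]
  refine le_trans (mul_le_mul_of_nonneg_left (le_trans (Complex.abs_re_le_norm _) (norm_chi_eq_one K q _).le) hq) (by rw [mul_one])

/-- ★★ **UPPER MASS BOUND**: `(lapF K c m²)⁻¹(x,x) ≤ 1∕m²` (`lapSym ≥ m²`). [cite: King1986, (4.4) p.670] -/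
theorem lapF_inv_diag_le_inv_mass (hc : 0 ≤ c) (hm : 0 < m2) (x : Tor K) : (lapF K c m2)⁻¹ x x ≤ m2⁻¹ := by
  rw [lapF_inv_diag_eq K hc hm x]
  have hq : ∀ q : Tor K, (lapSym K c m2 q)⁻¹ ≤ m2⁻¹ := fun q => inv_anti₀ hm (lapSym_ge K c m2 hc q)
  have hcard : (0 : ℝ) < Fintype.card (Tor K) := by exact_mod_cast Fintype.card_pos
  calc (Fintype.card (Tor K) : ℝ)⁻¹ * ∑ q : Tor K, (lapSym K c m2 q)⁻¹
      ≤ (Fintype.card (Tor K) : ℝ)⁻¹ * ∑ _q : Tor K, m2⁻¹ := mul_le_mul_of_nonneg_left (Finset.sum_le_sum fun q _ => hq q) (by positivity)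
    _ = m2⁻¹ := by rw [Finset.sum_const, Finset.card_univ, nsmul_eq_mul, ← mul_assoc, inv_mul_cancel₀ hcard.ne', one_mul]

omit hK in
/-- `lapSym ≤ m² + 4c(d+1)` (`2 − 2cos ≤ 4`). [cite: King1986, (4.4) p.670] -/
theorem lapSym_le (hc : 0 ≤ c) (m2 : ℝ) (q : Tor K) : lapSym K c m2 q ≤ m2 + 4 * c * (d + 1) := by
  unfold lapSym
  have hμ : ∀ μ : Fin (d + 1), 2 - 2 * Real.cos (Literature.MathematicalPhysics.QuantumFieldTheory.Balaban1983to89.B5Prop11Plancherel.sOf K q μ) ≤ 4 := fun μ => by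
    linarith [Real.neg_one_le_cos (Literature.MathematicalPhysics.QuantumFieldTheory.Balaban1983to89.B5Prop11Plancherel.sOf K q μ)]
  have hs : ∑ μ : Fin (d + 1), (2 - 2 * Real.cos (Literature.MathematicalPhysics.QuantumFieldTheory.Balaban1983to89.B5Prop11Plancherel.sOf K q μ)) ≤ 4 * (d + 1) := by
    have := Finset.sum_le_sum fun μ (_ : μ ∈ (Finset.univ : Finset (Fin (d + 1)))) => hμ μ
    rw [Finset.sum_const, Finset.card_univ, Fintype.card_fin, nsmul_eq_mul] at this
    push_cast at this
    linarith
  nlinarith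

/-- ★★ **LOWER MASS BOUND**: `(lapF K c m²)⁻¹(x,x) ≥ 1∕(m² + 4c(d+1))`. [cite: King1986, (4.4) p.670] -/
theorem inv_le_lapF_inv_diag (hc : 0 ≤ c) (hm : 0 < m2) (x : Tor K) : (m2 + 4 * c * (d + 1))⁻¹ ≤ (lapF K c m2)⁻¹ x x := by
  rw [lapF_inv_diag_eq K hc hm x]
  have hq : ∀ q : Tor K, (m2 + 4 * c * (d + 1))⁻¹ ≤ (lapSym K c m2 q)⁻¹ := fun q =>
    inv_anti₀ (lt_of_lt_of_le hm (lapSym_ge K c m2 hc q)) (lapSym_le K hc m2 q)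
  have hcard : (0 : ℝ) < Fintype.card (Tor K) := by exact_mod_cast Fintype.card_pos
  calc (m2 + 4 * c * (d + 1))⁻¹ = (Fintype.card (Tor K) : ℝ)⁻¹ * ∑ _q : Tor K, (m2 + 4 * c * (d + 1))⁻¹ := by
        rw [Finset.sum_const, Finset.card_univ, nsmul_eq_mul, ← mul_assoc, inv_mul_cancel₀ hcard.ne', one_mul]
    _ ≤ (Fintype.card (Tor K) : ℝ)⁻¹ * ∑ q : Tor K, (lapSym K c m2 q)⁻¹ := mul_le_mul_of_nonneg_left (Finset.sum_le_sum fun q _ => hq q) (by positivity)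

end Consequences

/-! ## §4 The dictionary with the B5 (1.29) dual-grid form of part Ε-b -/

section Dictionary

variable (K : Fin (d + 1) → ℕ) [hK : ∀ μ, NeZero (K μ)] {c m2 : ℝ}

/-- ★★ **THE DICTIONARY**: part Ε-b's dual-grid kernel at the representative difference EQUALS King's plane-wave sum —
`(Π_μK_μ)⁻¹Σ_k e^{ip′_k·(x̃−ỹ)}∕(m² + cΣ(2−2cos p′_{k,μ})) = |Ω|⁻¹Σ_q e^{iq·(x−y)}∕lapSym(q)` (both are `(lapF K c m²)⁻¹(x,y)`). [cite: Balaban1984PropagatorsI, (1.29) p.23; King1986,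
(4.4) p.670, (4.35) p.674] -/
theorem torusFreeKerC_eq_kingPlaneWave (hc : 0 ≤ c) (hm : 0 < m2) (x y : Tor K) :
    torusFreeKerC c m2 K (torRepZ K x - torRepZ K y) = kingPlaneWave c m2 K x y := by
  rw [← lapF_inv_eq_torusFreeKerC K hc hm, lapF_inv_eq_kingPlaneWave K hc hm]

/-- ★★ THE PERIODISED FREE KERNEL IN KING's PLANE WAVES: `Σ_{m∈ℤ^{d+1}} K_∞(x̃ − ỹ + (K_μm_μ)_μ) = |Ω|⁻¹ Σ_q e^{iq·(x−y)}∕lapSym(q)` (Poisson summation, King's vocabulary).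
[cite: Balaban1984PropagatorsI, p.36 l.20–23, (1.29) p.23; King1986, (4.4) p.670] -/
theorem tsum_freeKerC_translate_eq_kingPlaneWave (hc : 0 ≤ c) (hm : 0 < m2) (x y : Tor K) :
    ∑' m : Fin (d + 1) → ℤ, freeKerC c m2 (translate K (torRepZ K x - torRepZ K y) m) = kingPlaneWave c m2 K x y := by
  rw [← lapF_inv_eq_periodise K hc hm, lapF_inv_eq_kingPlaneWave K hc hm]

end Dictionary

end Summit.QuantumFields.YangMills.BalabanUVNodes.N15KingModelRung.TorusSpectral

end
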